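import Summits.QuantumAdvantage.QuantumAdvantage.Theorems.LightConeWindowHardB

/-! # LightConeWindowHard — part 3/3 (mechanical split for landing of `LightConeWindowHard`; content verbatim; scopes re-opened with their variables) -/

set_option linter.dupNamespace false
set_option linter.style.longLine false

namespace Summit.QuantumAdvantage.AdviceFreeQNC0.LightConeWindowHard
open Finset Summit.QuantumAdvantage.AdviceFreeQNC0
open Literature.Computability.QuantumComplexity Literature.Computability.QuantumComplexity.RingHLF

section UniformOdd

/-- LightConeWindowHard helper `inKernel_vUO` (decomp-qadv land package; see the module docstring). -/
theorem inKernel_vUO (r k : ℕ) (hk : 3 * r + 4 ≤ k) : InKernel (xUO r (2 * k + 1)) (vUO r (2 * k + 1)) := by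
  intro b
  rw [xor3_eq_false_iff]
  have hb := b.isLt
  simp only [vUO, xUO, Bool.and_eq_true, decide_eq_true_eq, ne_eq, decide_eq_decide, prv_val, nxt_val]
  split_ifs <;> omega

/-- LightConeWindowHard helper `edgesIn_vUO` (decomp-qadv land package; see the module docstring). -/
theorem edgesIn_vUO (r k : ℕ) (hk : 3 * r + 4 ≤ k) : edgesIn (vUO r (2 * k + 1)) = 2 * k + 1 - (4 * r + 6) := by
  unfold edgesIn
  have h : (univ.filter fun b : Fin (2 * k + 1) => vUO r _ b = true ∧ vUO r _ (nxt b) = true)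
      = (({2 * r + 2} : Finset ℕ) ∪ Finset.Ico (4 * r + 7) (2 * k + 1)).attachFin (by
          intro t ht
          rcases Finset.mem_union.1 ht with h | h
          · simp only [mem_singleton] at h; omega
          · exact (Finset.mem_Ico.1 h).2) := by
    ext b
    have hb := b.isLt
    simp only [mem_filter, mem_univ, true_and, mem_attachFin, vUO, decide_eq_true_eq, nxt_val, Finset.mem_union,
      Finset.mem_Ico, mem_singleton]
    split_ifs <;> omega
  rw [h, card_attachFin, Finset.card_union_of_disjoint (by
    rw [Finset.disjoint_left]; intro t ht ht'
    simp only [mem_singleton] at ht; have := (Finset.mem_Ico.1 ht').1; omega), card_singleton, Nat.card_Ico]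
  omega

/-- LightConeWindowHard helper `wtAnd_vUO` (decomp-qadv land package; see the module docstring). -/
theorem wtAnd_vUO (r k : ℕ) (hk : 3 * r + 4 ≤ k) : wtAnd (xUO r (2 * k + 1)) (vUO r (2 * k + 1)) = 4 := by
  unfold wtAnd
  have h : (univ.filter fun b : Fin (2 * k + 1) => xUO r _ b = true ∧ vUO r _ b = true)
      = ({0, 2 * r + 2, 2 * r + 3, 4 * r + 7} : Finset ℕ).attachFin (by
          intro t ht; simp only [mem_insert, mem_singleton] at ht; omega) := by
    ext b
    have hb := b.isLt
    simp only [mem_filter, mem_univ, true_and, mem_attachFin, vUO, xUO, decide_eq_true_eq, mem_insert, mem_singleton]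
    omega
  rw [h, card_attachFin, card_insert_of_notMem (by simp only [mem_insert, mem_singleton]; omega),
    card_insert_of_notMem (by simp only [mem_insert, mem_singleton]; omega), card_pair (by omega)]

/-- LightConeWindowHard helper `signBit_vUO` (decomp-qadv land package; see the module docstring). -/
theorem signBit_vUO (r k : ℕ) (hk : 3 * r + 4 ≤ k) : signBit (xUO r (2 * k + 1)) (vUO r (2 * k + 1)) = 1 := by
  unfold signBit; rw [edgesIn_vUO r k hk, wtAnd_vUO r k hk]; omega

/-- LightConeWindowHard helper `oddZeros_xUO` (decomp-qadv land package; see the module docstring). -/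
theorem oddZeros_xUO (r k : ℕ) (hk : 3 * r + 4 ≤ k) : OddZeros (xUO r (2 * k + 1)) := by
  unfold OddZeros
  have h : (univ.filter fun b : Fin (2 * k + 1) => xUO r _ b = false)
      = univ \ ({0, 1, 2 * r + 2, 2 * r + 3, 4 * r + 6, 4 * r + 7} : Finset ℕ).attachFin (by
          intro t ht; simp only [mem_insert, mem_singleton] at ht; omega) := by
    ext b
    simp only [mem_filter, mem_univ, true_and, mem_sdiff, mem_attachFin, xUO, decide_eq_false_iff_not, mem_insert,
      mem_singleton]
  rw [h, card_sdiff_of_subset (subset_univ _), card_attachFin, card_univ, Fintype.card_fin]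
  have h6 : ({0, 1, 2 * r + 2, 2 * r + 3, 4 * r + 6, 4 * r + 7} : Finset ℕ).card = 6 := by
    rw [card_insert_of_notMem (by simp only [mem_insert, mem_singleton]; omega),
      card_insert_of_notMem (by simp only [mem_insert, mem_singleton]; omega),
      card_insert_of_notMem (by simp only [mem_insert, mem_singleton]; omega),
      card_insert_of_notMem (by simp only [mem_insert, mem_singleton]; omega), card_pair (by omega)]
  rw [h6]; omega

set_option maxHeartbeats 4000000 in
/-- LightConeWindowHard helper `σUO_val` (decomp-qadv land package; see the module docstring). -/
theorem σUO_val (r k : ℕ) (hk : 3 * r + 4 ≤ k) (b : Fin (2 * k + 1)) (hb : vUO r _ b = true) :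
    (((b : ℕ) = 0) ∧ ((σUO r k b : Fin _) : ℕ) = 2 * r + 2) ∨
    (((b : ℕ) = 2 * r + 2) ∧ ((σUO r k b : Fin _) : ℕ) = 0) ∨
    (((b : ℕ) % 2 = 0 ∧ 2 ≤ (b : ℕ) ∧ (b : ℕ) ≤ r) ∧ ((σUO r k b : Fin _) : ℕ) = (b : ℕ) + (4 * r + 6)) ∨
    (((b : ℕ) % 2 = 0 ∧ 4 * r + 8 ≤ (b : ℕ) ∧ (b : ℕ) ≤ 5 * r + 6) ∧ ((σUO r k b : Fin _) : ℕ) = (b : ℕ) - (4 * r + 6)) ∨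
    ((r % 2 = 1 ∧ (b : ℕ) = r + 1) ∧ ((σUO r k b : Fin _) : ℕ) = 5 * r + 7) ∨
    ((r % 2 = 0 ∧ 2 ≤ r ∧ (b : ℕ) = 3 * r + 3) ∧ ((σUO r k b : Fin _) : ℕ) = 5 * r + 7) ∨
    ((r % 2 = 1 ∧ (b : ℕ) = 5 * r + 7) ∧ ((σUO r k b : Fin _) : ℕ) = r + 1) ∨
    ((r % 2 = 0 ∧ 2 ≤ r ∧ (b : ℕ) = 5 * r + 7) ∧ ((σUO r k b : Fin _) : ℕ) = 3 * r + 3) ∨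
    ((r % 2 = 0 ∧ 2 ≤ r ∧ (b : ℕ) = r + 2) ∧ ((σUO r k b : Fin _) : ℕ) = (2 * k + 1) - r) ∨
    ((r % 2 = 1 ∧ (b : ℕ) = 3 * r + 6) ∧ ((σUO r k b : Fin _) : ℕ) = (2 * k + 1) - r) ∨
    ((r % 2 = 0 ∧ 2 ≤ r ∧ (b : ℕ) = (2 * k + 1) - r) ∧ ((σUO r k b : Fin _) : ℕ) = r + 2) ∨
    ((r % 2 = 1 ∧ (b : ℕ) = (2 * k + 1) - r) ∧ ((σUO r k b : Fin _) : ℕ) = 3 * r + 6) ∨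
    (((b : ℕ) % 2 = 0 ∧ r + 3 ≤ (b : ℕ) ∧ (b : ℕ) ≤ 2 * r) ∧ ((σUO r k b : Fin _) : ℕ) = (2 * k + 1) - (2 * r + 2 - (b : ℕ))) ∨
    (((b : ℕ) % 2 = 1 ∧ (2 * k + 1) - r + 1 ≤ (b : ℕ)) ∧ ((σUO r k b : Fin _) : ℕ) = (b : ℕ) + (2 * r + 2) - (2 * k + 1)) ∨
    (((b : ℕ) = 2 * r + 3) ∧ ((σUO r k b : Fin _) : ℕ) = 4 * r + 7) ∨
    (((b : ℕ) = 4 * r + 7) ∧ ((σUO r k b : Fin _) : ℕ) = 2 * r + 3) ∨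
    (((b : ℕ) % 2 = 1 ∧ 2 * r + 5 ≤ (b : ℕ) ∧ (b : ℕ) ≤ 3 * r + 2) ∧ ((σUO r k b : Fin _) : ℕ) = (b : ℕ) + (2 * r + 4)) ∨
    (((b : ℕ) % 2 = 1 ∧ 4 * r + 9 ≤ (b : ℕ) ∧ (b : ℕ) ≤ 5 * r + 6) ∧ ((σUO r k b : Fin _) : ℕ) = (b : ℕ) - (2 * r + 4)) ∨
    (((b : ℕ) = 3 * r + 5 - r % 2) ∧ ((σUO r k b : Fin _) : ℕ) = 5 * r + 8) ∨
    (((b : ℕ) = 5 * r + 8) ∧ ((σUO r k b : Fin _) : ℕ) = 3 * r + 5 - r % 2) ∨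
    (((b : ℕ) % 2 = 1 ∧ 3 * r + 7 ≤ (b : ℕ) ∧ (b : ℕ) ≤ 4 * r + 5) ∧ ((σUO r k b : Fin _) : ℕ) = (2 * k + 1) - (4 * r + 6 - (b : ℕ))) ∨
    (((b : ℕ) % 2 = 0 ∧ (2 * k + 1) - r + 1 ≤ (b : ℕ)) ∧ ((σUO r k b : Fin _) : ℕ) = (b : ℕ) + (4 * r + 6) - (2 * k + 1)) ∨
    ((5 * r + 9 ≤ (b : ℕ) ∧ (b : ℕ) + r + 2 ≤ (2 * k + 1) ∧ ((b : ℕ) + r) % 2 = 1) ∧ ((σUO r k b : Fin _) : ℕ) = (b : ℕ) + 1) ∨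
    ((5 * r + 10 ≤ (b : ℕ) ∧ (b : ℕ) + r + 1 ≤ (2 * k + 1) ∧ ((b : ℕ) + r) % 2 = 0) ∧ ((σUO r k b : Fin _) : ℕ) = (b : ℕ) - 1) := by
  have hlt := b.isLt
  simp only [vUO, decide_eq_true_eq] at hb
  simp only [σUO, Fin.val_mk]
  generalize htt : (b : ℕ) = t at *
  rcases VUO_cases r k t hk hlt hb with hc | hc | hc | hc | hc | hc | hc | hc | hc | hc | hc | hc | hc | hc | hc | hc | hc | hc | hc | hc | hc | hc | hc | hc
  · clear hb
    have e : σUOval r (2 * k + 1) t = 2 * r + 2 := by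
      unfold σUOval
      rw [if_pos hc]
    rw [e]
    exact Or.inl ⟨hc, by omega⟩
  · clear hb
    have e : σUOval r (2 * k + 1) t = 0 := by
      unfold σUOval
      rw [if_neg (show ¬(t = 0) by omega), if_pos hc]
    rw [e]
    exact Or.inr (Or.inl ⟨hc, by omega⟩)
  · clear hb
    have e : σUOval r (2 * k + 1) t = t + (4 * r + 6) := by
      unfold σUOval
      rw [if_neg (show ¬(t = 0) by omega), if_neg (show ¬(t = 2 * r + 2) by omega), if_pos hc]
    rw [e]
    exact Or.inr (Or.inr (Or.inl ⟨hc, by omega⟩))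
  · clear hb
    have e : σUOval r (2 * k + 1) t = t - (4 * r + 6) := by
      unfold σUOval
      rw [if_neg (show ¬(t = 0) by omega), if_neg (show ¬(t = 2 * r + 2) by omega), if_neg (show ¬(t % 2 = 0 ∧ 2 ≤ t ∧ t ≤ r) by omega), if_pos hc]
    rw [e]
    exact Or.inr (Or.inr (Or.inr (Or.inl ⟨hc, by omega⟩)))
  · clear hb
    have e : σUOval r (2 * k + 1) t = 5 * r + 7 := by
      unfold σUOval
      rw [if_neg (show ¬(t = 0) by omega), if_neg (show ¬(t = 2 * r + 2) by omega), if_neg (show ¬(t % 2 = 0 ∧ 2 ≤ t ∧ t ≤ r) by omega), if_neg (show ¬(t % 2 = 0 ∧ 4 * r + 8 ≤ t ∧ t ≤ 5 * r + 6) by omega), if_pos hc]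
    rw [e]
    exact Or.inr (Or.inr (Or.inr (Or.inr (Or.inl ⟨hc, by omega⟩))))
  · clear hb
    have e : σUOval r (2 * k + 1) t = 5 * r + 7 := by
      unfold σUOval
      rw [if_neg (show ¬(t = 0) by omega), if_neg (show ¬(t = 2 * r + 2) by omega), if_neg (show ¬(t % 2 = 0 ∧ 2 ≤ t ∧ t ≤ r) by omega), if_neg (show ¬(t % 2 = 0 ∧ 4 * r + 8 ≤ t ∧ t ≤ 5 * r + 6) by omega), if_neg (show ¬(r % 2 = 1 ∧ t = r + 1) by omega), if_pos hc]
    rw [e]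
    exact Or.inr (Or.inr (Or.inr (Or.inr (Or.inr (Or.inl ⟨hc, by omega⟩)))))
  · clear hb
    have e : σUOval r (2 * k + 1) t = r + 1 := by
      unfold σUOval
      rw [if_neg (show ¬(t = 0) by omega), if_neg (show ¬(t = 2 * r + 2) by omega), if_neg (show ¬(t % 2 = 0 ∧ 2 ≤ t ∧ t ≤ r) by omega), if_neg (show ¬(t % 2 = 0 ∧ 4 * r + 8 ≤ t ∧ t ≤ 5 * r + 6) by omega), if_neg (show ¬(r % 2 = 1 ∧ t = r + 1) by omega), if_neg (show ¬(r % 2 = 0 ∧ 2 ≤ r ∧ t = 3 * r + 3) by omega), if_pos hc]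
    rw [e]
    exact Or.inr (Or.inr (Or.inr (Or.inr (Or.inr (Or.inr (Or.inl ⟨hc, by omega⟩))))))
  · clear hb
    have e : σUOval r (2 * k + 1) t = 3 * r + 3 := by
      unfold σUOval
      rw [if_neg (show ¬(t = 0) by omega), if_neg (show ¬(t = 2 * r + 2) by omega), if_neg (show ¬(t % 2 = 0 ∧ 2 ≤ t ∧ t ≤ r) by omega), if_neg (show ¬(t % 2 = 0 ∧ 4 * r + 8 ≤ t ∧ t ≤ 5 * r + 6) by omega), if_neg (show ¬(r % 2 = 1 ∧ t = r + 1) by omega), if_neg (show ¬(r % 2 = 0 ∧ 2 ≤ r ∧ t = 3 * r + 3) by omega), if_neg (show ¬(r % 2 = 1 ∧ t = 5 * r + 7) by omega), if_pos hc]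
    rw [e]
    exact Or.inr (Or.inr (Or.inr (Or.inr (Or.inr (Or.inr (Or.inr (Or.inl ⟨hc, by omega⟩)))))))
  · clear hb
    have e : σUOval r (2 * k + 1) t = (2 * k + 1) - r := by
      unfold σUOval
      rw [if_neg (show ¬(t = 0) by omega), if_neg (show ¬(t = 2 * r + 2) by omega), if_neg (show ¬(t % 2 = 0 ∧ 2 ≤ t ∧ t ≤ r) by omega), if_neg (show ¬(t % 2 = 0 ∧ 4 * r + 8 ≤ t ∧ t ≤ 5 * r + 6) by omega), if_neg (show ¬(r % 2 = 1 ∧ t = r + 1) by omega), if_neg (show ¬(r % 2 = 0 ∧ 2 ≤ r ∧ t = 3 * r + 3) by omega), if_neg (show ¬(r % 2 = 1 ∧ t = 5 * r + 7) by omega), if_neg (show ¬(r % 2 = 0 ∧ 2 ≤ r ∧ t = 5 * r + 7) by omega), if_pos hc]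
    rw [e]
    exact Or.inr (Or.inr (Or.inr (Or.inr (Or.inr (Or.inr (Or.inr (Or.inr (Or.inl ⟨hc, by omega⟩))))))))
  · clear hb
    have e : σUOval r (2 * k + 1) t = (2 * k + 1) - r := by
      unfold σUOval
      rw [if_neg (show ¬(t = 0) by omega), if_neg (show ¬(t = 2 * r + 2) by omega), if_neg (show ¬(t % 2 = 0 ∧ 2 ≤ t ∧ t ≤ r) by omega), if_neg (show ¬(t % 2 = 0 ∧ 4 * r + 8 ≤ t ∧ t ≤ 5 * r + 6) by omega), if_neg (show ¬(r % 2 = 1 ∧ t = r + 1) by omega), if_neg (show ¬(r % 2 = 0 ∧ 2 ≤ r ∧ t = 3 * r + 3) by omega), if_neg (show ¬(r % 2 = 1 ∧ t = 5 * r + 7) by omega), if_neg (show ¬(r % 2 = 0 ∧ 2 ≤ r ∧ t = 5 * r + 7) by omega), if_neg (show ¬(r % 2 = 0 ∧ 2 ≤ r ∧ t = r + 2) by omega), if_pos hc]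
    rw [e]
    exact Or.inr (Or.inr (Or.inr (Or.inr (Or.inr (Or.inr (Or.inr (Or.inr (Or.inr (Or.inl ⟨hc, by omega⟩)))))))))
  · clear hb
    have e : σUOval r (2 * k + 1) t = r + 2 := by
      unfold σUOval
      rw [if_neg (show ¬(t = 0) by omega), if_neg (show ¬(t = 2 * r + 2) by omega), if_neg (show ¬(t % 2 = 0 ∧ 2 ≤ t ∧ t ≤ r) by omega), if_neg (show ¬(t % 2 = 0 ∧ 4 * r + 8 ≤ t ∧ t ≤ 5 * r + 6) by omega), if_neg (show ¬(r % 2 = 1 ∧ t = r + 1) by omega), if_neg (show ¬(r % 2 = 0 ∧ 2 ≤ r ∧ t = 3 * r + 3) by omega), if_neg (show ¬(r % 2 = 1 ∧ t = 5 * r + 7) by omega), if_neg (show ¬(r % 2 = 0 ∧ 2 ≤ r ∧ t = 5 * r + 7) by omega), if_neg (show ¬(r % 2 = 0 ∧ 2 ≤ r ∧ t = r + 2) by omega), if_neg (show ¬(r % 2 = 1 ∧ t = 3 * r + 6) by omega), if_pos hc]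
    rw [e]
    exact Or.inr (Or.inr (Or.inr (Or.inr (Or.inr (Or.inr (Or.inr (Or.inr (Or.inr (Or.inr (Or.inl ⟨hc, by omega⟩))))))))))
  · clear hb
    have e : σUOval r (2 * k + 1) t = 3 * r + 6 := by
      unfold σUOval
      rw [if_neg (show ¬(t = 0) by omega), if_neg (show ¬(t = 2 * r + 2) by omega), if_neg (show ¬(t % 2 = 0 ∧ 2 ≤ t ∧ t ≤ r) by omega), if_neg (show ¬(t % 2 = 0 ∧ 4 * r + 8 ≤ t ∧ t ≤ 5 * r + 6) by omega), if_neg (show ¬(r % 2 = 1 ∧ t = r + 1) by omega), if_neg (show ¬(r % 2 = 0 ∧ 2 ≤ r ∧ t = 3 * r + 3) by omega), if_neg (show ¬(r % 2 = 1 ∧ t = 5 * r + 7) by omega), if_neg (show ¬(r % 2 = 0 ∧ 2 ≤ r ∧ t = 5 * r + 7) by omega), if_neg (show ¬(r % 2 = 0 ∧ 2 ≤ r ∧ t = r + 2) by omega), if_neg (show ¬(r % 2 = 1 ∧ t = 3 * r + 6) by omega), if_neg (show ¬(r % 2 = 0 ∧ 2 ≤ r ∧ t = (2 * k + 1) - r)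 by omega), if_pos hc]
    rw [e]
    exact Or.inr (Or.inr (Or.inr (Or.inr (Or.inr (Or.inr (Or.inr (Or.inr (Or.inr (Or.inr (Or.inr (Or.inl ⟨hc, by omega⟩)))))))))))
  · clear hb
    have e : σUOval r (2 * k + 1) t = (2 * k + 1) - (2 * r + 2 - t) := by
      unfold σUOval
      rw [if_neg (show ¬(t = 0) by omega), if_neg (show ¬(t = 2 * r + 2) by omega), if_neg (show ¬(t % 2 = 0 ∧ 2 ≤ t ∧ t ≤ r) by omega), if_neg (show ¬(t % 2 = 0 ∧ 4 * r + 8 ≤ t ∧ t ≤ 5 * r + 6) by omega), if_neg (show ¬(r % 2 = 1 ∧ t = r + 1) by omega), if_neg (show ¬(r % 2 = 0 ∧ 2 ≤ r ∧ t = 3 * r + 3) by omega), if_neg (show ¬(r % 2 = 1 ∧ t = 5 * r + 7) by omega), if_neg (show ¬(r % 2 = 0 ∧ 2 ≤ r ∧ t = 5 * r + 7) by omega), if_neg (show ¬(r % 2 = 0 ∧ 2 ≤ r ∧ t = r + 2) by omega), if_neg (show ¬(r % 2 = 1 ∧ t = 3 * r + 6) by omega), if_neg (show ¬(r % 2 =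 0 ∧ 2 ≤ r ∧ t = (2 * k + 1) - r) by omega), if_neg (show ¬(r % 2 = 1 ∧ t = (2 * k + 1) - r) by omega), if_pos hc]
    rw [e]
    exact Or.inr (Or.inr (Or.inr (Or.inr (Or.inr (Or.inr (Or.inr (Or.inr (Or.inr (Or.inr (Or.inr (Or.inr (Or.inl ⟨hc, by omega⟩))))))))))))
  · clear hb
    have e : σUOval r (2 * k + 1) t = t + (2 * r + 2) - (2 * k + 1) := by
      unfold σUOval
      rw [if_neg (show ¬(t = 0) by omega), if_neg (show ¬(t = 2 * r + 2) by omega), if_neg (show ¬(t % 2 = 0 ∧ 2 ≤ t ∧ t ≤ r) by omega), if_neg (show ¬(t % 2 = 0 ∧ 4 * r + 8 ≤ t ∧ t ≤ 5 * r + 6) by omega), if_neg (show ¬(r % 2 = 1 ∧ t = r + 1) by omega), if_neg (show ¬(r % 2 = 0 ∧ 2 ≤ r ∧ t = 3 * r + 3) by omega), if_neg (show ¬(r % 2 = 1 ∧ t = 5 * r + 7) by omega), if_neg (show ¬(r % 2 = 0 ∧ 2 ≤ r ∧ t = 5 * r + 7) by omega), if_neg (show ¬(r % 2 = 0 ∧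 2 ≤ r ∧ t = r + 2) by omega), if_neg (show ¬(r % 2 = 1 ∧ t = 3 * r + 6) by omega), if_neg (show ¬(r % 2 = 0 ∧ 2 ≤ r ∧ t = (2 * k + 1) - r) by omega), if_neg (show ¬(r % 2 = 1 ∧ t = (2 * k + 1) - r) by omega), if_neg (show ¬(t % 2 = 0 ∧ r + 3 ≤ t ∧ t ≤ 2 * r) by omega), if_pos hc]
    rw [e]
    exact Or.inr (Or.inr (Or.inr (Or.inr (Or.inr (Or.inr (Or.inr (Or.inr (Or.inr (Or.inr (Or.inr (Or.inr (Or.inr (Or.inl ⟨hc, by omega⟩)))))))))))))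
  · clear hb
    have e : σUOval r (2 * k + 1) t = 4 * r + 7 := by
      unfold σUOval
      rw [if_neg (show ¬(t = 0) by omega), if_neg (show ¬(t = 2 * r + 2) by omega), if_neg (show ¬(t % 2 = 0 ∧ 2 ≤ t ∧ t ≤ r) by omega), if_neg (show ¬(t % 2 = 0 ∧ 4 * r + 8 ≤ t ∧ t ≤ 5 * r + 6) by omega), if_neg (show ¬(r % 2 = 1 ∧ t = r + 1) by omega), if_neg (show ¬(r % 2 = 0 ∧ 2 ≤ r ∧ t = 3 * r + 3) by omega), if_neg (show ¬(r % 2 = 1 ∧ t = 5 * r + 7) by omega), if_neg (show ¬(r % 2 = 0 ∧ 2 ≤ r ∧ t = 5 * r + 7) by omega), if_neg (show ¬(r % 2 = 0 ∧ 2 ≤ r ∧ t = r + 2) by omega), if_neg (show ¬(r % 2 = 1 ∧ t = 3 * r + 6) by omega), if_neg (show ¬(r % 2 = 0 ∧ 2 ≤ r ∧ t = (2 * k + 1) - r) by omega), if_neg (show ¬(r % 2 = 1 ∧ t = (2 * k + 1) - r) by omega), if_neg (show ¬(t % 2 = 0 ∧ r + 3 ≤ t ∧ t ≤ 2 * r)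 by omega), if_neg (show ¬(t % 2 = 1 ∧ (2 * k + 1) - r + 1 ≤ t) by omega), if_pos hc]
    rw [e]
    exact Or.inr (Or.inr (Or.inr (Or.inr (Or.inr (Or.inr (Or.inr (Or.inr (Or.inr (Or.inr (Or.inr (Or.inr (Or.inr (Or.inr (Or.inl ⟨hc, by omega⟩))))))))))))))
  · clear hb
    have e : σUOval r (2 * k + 1) t = 2 * r + 3 := by
      unfold σUOval
      rw [if_neg (show ¬(t = 0) by omega), if_neg (show ¬(t = 2 * r + 2) by omega), if_neg (show ¬(t % 2 = 0 ∧ 2 ≤ t ∧ t ≤ r) by omega), if_neg (show ¬(t % 2 = 0 ∧ 4 * r + 8 ≤ t ∧ t ≤ 5 * r + 6) by omega), if_neg (show ¬(r % 2 = 1 ∧ t = r + 1) by omega), if_neg (show ¬(r % 2 = 0 ∧ 2 ≤ r ∧ t = 3 * r + 3) by omega), if_neg (show ¬(r % 2 = 1 ∧ t = 5 * r + 7) by omega), if_neg (show ¬(r % 2 = 0 ∧ 2 ≤ r ∧ t = 5 * r + 7) by omega), if_neg (show ¬(r % 2 = 0 ∧ 2 ≤ r ∧ t = r + 2) by omega),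 if_neg (show ¬(r % 2 = 1 ∧ t = 3 * r + 6) by omega), if_neg (show ¬(r % 2 = 0 ∧ 2 ≤ r ∧ t = (2 * k + 1) - r) by omega), if_neg (show ¬(r % 2 = 1 ∧ t = (2 * k + 1) - r) by omega), if_neg (show ¬(t % 2 = 0 ∧ r + 3 ≤ t ∧ t ≤ 2 * r) by omega), if_neg (show ¬(t % 2 = 1 ∧ (2 * k + 1) - r + 1 ≤ t) by omega), if_neg (show ¬(t = 2 * r + 3) by omega), if_pos hc]
    rw [e]
    exact Or.inr (Or.inr (Or.inr (Or.inr (Or.inr (Or.inr (Or.inr (Or.inr (Or.inr (Or.inr (Or.inr (Or.inr (Or.inr (Or.inr (Or.inr (Or.inl ⟨hc, by omega⟩)))))))))))))))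
  · clear hb
    have e : σUOval r (2 * k + 1) t = t + (2 * r + 4) := by
      unfold σUOval
      rw [if_neg (show ¬(t = 0) by omega), if_neg (show ¬(t = 2 * r + 2) by omega), if_neg (show ¬(t % 2 = 0 ∧ 2 ≤ t ∧ t ≤ r) by omega), if_neg (show ¬(t % 2 = 0 ∧ 4 * r + 8 ≤ t ∧ t ≤ 5 * r + 6) by omega), if_neg (show ¬(r % 2 = 1 ∧ t = r + 1) by omega), if_neg (show ¬(r % 2 = 0 ∧ 2 ≤ r ∧ t = 3 * r + 3) by omega), if_neg (show ¬(r % 2 = 1 ∧ t = 5 * r + 7) by omega), if_neg (show ¬(r % 2 = 0 ∧ 2 ≤ r ∧ t = 5 * r + 7) by omega), if_neg (show ¬(r % 2 = 0 ∧ 2 ≤ r ∧ t = r + 2) by omega), if_neg (show ¬(r % 2 = 1 ∧ t = 3 * r + 6) by omega), if_neg (show ¬(r % 2 = 0 ∧ 2 ≤ r ∧ t = (2 * k + 1) - r) by omega), if_neg (show ¬(r % 2 = 1 ∧ t = (2 * k + 1) - r) by omega), if_neg (show ¬(t % 2 = 0 ∧ r + 3 ≤ t ∧ t ≤ 2 *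 r) by omega), if_neg (show ¬(t % 2 = 1 ∧ (2 * k + 1) - r + 1 ≤ t) by omega), if_neg (show ¬(t = 2 * r + 3) by omega), if_neg (show ¬(t = 4 * r + 7) by omega), if_pos hc]
    rw [e]
    exact Or.inr (Or.inr (Or.inr (Or.inr (Or.inr (Or.inr (Or.inr (Or.inr (Or.inr (Or.inr (Or.inr (Or.inr (Or.inr (Or.inr (Or.inr (Or.inr (Or.inl ⟨hc, by omega⟩))))))))))))))))
  · clear hb
    have e : σUOval r (2 * k + 1) t = t - (2 * r + 4) := by
      unfold σUOval
      rw [if_neg (show ¬(t = 0) by omega), if_neg (show ¬(t = 2 * r + 2) by omega), if_neg (show ¬(t % 2 = 0 ∧ 2 ≤ t ∧ t ≤ r) by omega), if_neg (show ¬(t % 2 = 0 ∧ 4 * r + 8 ≤ t ∧ t ≤ 5 * r + 6) by omega), if_neg (show ¬(r % 2 = 1 ∧ t = r + 1) by omega), if_neg (show ¬(r % 2 = 0 ∧ 2 ≤ r ∧ t = 3 * r + 3) by omega), if_neg (show ¬(r % 2 = 1 ∧ t = 5 * r + 7) by omega), if_neg (show ¬(r % 2 = 0 ∧ 2 ≤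 r ∧ t = 5 * r + 7) by omega), if_neg (show ¬(r % 2 = 0 ∧ 2 ≤ r ∧ t = r + 2) by omega), if_neg (show ¬(r % 2 = 1 ∧ t = 3 * r + 6) by omega), if_neg (show ¬(r % 2 = 0 ∧ 2 ≤ r ∧ t = (2 * k + 1) - r) by omega), if_neg (show ¬(r % 2 = 1 ∧ t = (2 * k + 1) - r) by omega), if_neg (show ¬(t % 2 = 0 ∧ r + 3 ≤ t ∧ t ≤ 2 * r) by omega), if_neg (show ¬(t % 2 = 1 ∧ (2 * k + 1) - r + 1 ≤ t) by omega), if_neg (show ¬(t = 2 * r + 3) by omega), if_neg (show ¬(t = 4 * r + 7) by omega), if_neg (show ¬(t % 2 = 1 ∧ 2 * r + 5 ≤ t ∧ t ≤ 3 * r + 2) by omega), if_pos hc]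
    rw [e]
    exact Or.inr (Or.inr (Or.inr (Or.inr (Or.inr (Or.inr (Or.inr (Or.inr (Or.inr (Or.inr (Or.inr (Or.inr (Or.inr (Or.inr (Or.inr (Or.inr (Or.inr (Or.inl ⟨hc, by omega⟩)))))))))))))))))
  · clear hb
    have e : σUOval r (2 * k + 1) t = 5 * r + 8 := by
      unfold σUOval
      rw [if_neg (show ¬(t = 0) by omega), if_neg (show ¬(t = 2 * r + 2) by omega), if_neg (show ¬(t % 2 = 0 ∧ 2 ≤ t ∧ t ≤ r) by omega), if_neg (show ¬(t % 2 = 0 ∧ 4 * r + 8 ≤ t ∧ t ≤ 5 * r + 6) by omega), if_neg (show ¬(r % 2 = 1 ∧ t = r + 1) by omega), if_neg (show ¬(r % 2 = 0 ∧ 2 ≤ r ∧ t = 3 * r + 3) by omega), if_neg (show ¬(r % 2 = 1 ∧ t = 5 * r + 7) by omega), if_neg (show ¬(r % 2 = 0 ∧ 2 ≤ r ∧ t = 5 * r + 7) by omega), if_neg (show ¬(r % 2 = 0 ∧ 2 ≤ r ∧ t = r + 2) by omega), if_neg (show ¬(r % 2 = 1 ∧ t = 3 * r + 6) by omega), if_neg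 (show ¬(r % 2 = 0 ∧ 2 ≤ r ∧ t = (2 * k + 1) - r) by omega), if_neg (show ¬(r % 2 = 1 ∧ t = (2 * k + 1) - r) by omega), if_neg (show ¬(t % 2 = 0 ∧ r + 3 ≤ t ∧ t ≤ 2 * r) by omega), if_neg (show ¬(t % 2 = 1 ∧ (2 * k + 1) - r + 1 ≤ t) by omega), if_neg (show ¬(t = 2 * r + 3) by omega), if_neg (show ¬(t = 4 * r + 7) by omega), if_neg (show ¬(t % 2 = 1 ∧ 2 * r + 5 ≤ t ∧ t ≤ 3 * r + 2) by omega), if_neg (show ¬(t % 2 = 1 ∧ 4 * r + 9 ≤ t ∧ t ≤ 5 * r + 6) by omega), if_pos hc]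
    rw [e]
    exact Or.inr (Or.inr (Or.inr (Or.inr (Or.inr (Or.inr (Or.inr (Or.inr (Or.inr (Or.inr (Or.inr (Or.inr (Or.inr (Or.inr (Or.inr (Or.inr (Or.inr (Or.inr (Or.inl ⟨hc, by omega⟩))))))))))))))))))
  · clear hb
    have e : σUOval r (2 * k + 1) t = 3 * r + 5 - r % 2 := by
      unfold σUOval
      rw [if_neg (show ¬(t = 0) by omega), if_neg (show ¬(t = 2 * r + 2) by omega), if_neg (show ¬(t % 2 = 0 ∧ 2 ≤ t ∧ t ≤ r) by omega), if_neg (show ¬(t % 2 = 0 ∧ 4 * r + 8 ≤ t ∧ t ≤ 5 * r + 6) by omega), if_neg (show ¬(r % 2 = 1 ∧ t = r + 1) by omega), if_neg (show ¬(r % 2 = 0 ∧ 2 ≤ r ∧ t = 3 * r + 3) by omega), if_neg (show ¬(r % 2 = 1 ∧ t = 5 * r + 7) by omega), if_neg (show ¬(r % 2 = 0 ∧ 2 ≤ r ∧ t = 5 * r + 7) by omega), if_neg (show ¬(r % 2 = 0 ∧ 2 ≤ r ∧ t = r + 2) by omega), if_neg (show ¬(r % 2 = 1 ∧ t = 3 *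 r + 6) by omega), if_neg (show ¬(r % 2 = 0 ∧ 2 ≤ r ∧ t = (2 * k + 1) - r) by omega), if_neg (show ¬(r % 2 = 1 ∧ t = (2 * k + 1) - r) by omega), if_neg (show ¬(t % 2 = 0 ∧ r + 3 ≤ t ∧ t ≤ 2 * r) by omega), if_neg (show ¬(t % 2 = 1 ∧ (2 * k + 1) - r + 1 ≤ t) by omega), if_neg (show ¬(t = 2 * r + 3) by omega), if_neg (show ¬(t = 4 * r + 7) by omega), if_neg (show ¬(t % 2 = 1 ∧ 2 * r + 5 ≤ t ∧ t ≤ 3 * r + 2) by omega), if_neg (show ¬(t % 2 = 1 ∧ 4 * r + 9 ≤ t ∧ t ≤ 5 * r + 6) by omega), if_neg (show ¬(t = 3 * r + 5 - r % 2) by omega), if_pos hc]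
    rw [e]
    exact Or.inr (Or.inr (Or.inr (Or.inr (Or.inr (Or.inr (Or.inr (Or.inr (Or.inr (Or.inr (Or.inr (Or.inr (Or.inr (Or.inr (Or.inr (Or.inr (Or.inr (Or.inr (Or.inr (Or.inl ⟨hc, by omega⟩)))))))))))))))))))
  · clear hb
    have e : σUOval r (2 * k + 1) t = (2 * k + 1) - (4 * r + 6 - t) := by
      unfold σUOval
      rw [if_neg (show ¬(t = 0) by omega), if_neg (show ¬(t = 2 * r + 2) by omega), if_neg (show ¬(t % 2 = 0 ∧ 2 ≤ t ∧ t ≤ r) by omega), if_neg (show ¬(t % 2 = 0 ∧ 4 * r + 8 ≤ t ∧ t ≤ 5 * r + 6) by omega), if_neg (show ¬(r % 2 = 1 ∧ t = r + 1) by omega), if_neg (show ¬(r % 2 = 0 ∧ 2 ≤ r ∧ t = 3 * r + 3) by omega), if_neg (show ¬(r % 2 = 1 ∧ t = 5 * r + 7) by omega), if_neg (show ¬(r % 2 = 0 ∧ 2 ≤ r ∧ t = 5 * r + 7) by omega), if_neg (show ¬(r % 2 = 0 ∧ 2 ≤ r ∧ t = r + 2) by omega), if_neg (show ¬(r % 2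 = 1 ∧ t = 3 * r + 6) by omega), if_neg (show ¬(r % 2 = 0 ∧ 2 ≤ r ∧ t = (2 * k + 1) - r) by omega), if_neg (show ¬(r % 2 = 1 ∧ t = (2 * k + 1) - r) by omega), if_neg (show ¬(t % 2 = 0 ∧ r + 3 ≤ t ∧ t ≤ 2 * r) by omega), if_neg (show ¬(t % 2 = 1 ∧ (2 * k + 1) - r + 1 ≤ t) by omega), if_neg (show ¬(t = 2 * r + 3) by omega), if_neg (show ¬(t = 4 * r + 7) by omega), if_neg (show ¬(t % 2 = 1 ∧ 2 * r + 5 ≤ t ∧ t ≤ 3 * r + 2) by omega), if_neg (show ¬(t % 2 = 1 ∧ 4 * r + 9 ≤ t ∧ t ≤ 5 * r + 6) by omega), if_neg (show ¬(t = 3 * r + 5 - r % 2) by omega), if_neg (show ¬(t = 5 * r + 8) by omega), if_pos hc]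
    rw [e]
    exact Or.inr (Or.inr (Or.inr (Or.inr (Or.inr (Or.inr (Or.inr (Or.inr (Or.inr (Or.inr (Or.inr (Or.inr (Or.inr (Or.inr (Or.inr (Or.inr (Or.inr (Or.inr (Or.inr (Or.inr (Or.inl ⟨hc, by omega⟩))))))))))))))))))))
  · clear hb
    have e : σUOval r (2 * k + 1) t = t + (4 * r + 6) - (2 * k + 1) := by
      unfold σUOval
      rw [if_neg (show ¬(t = 0) by omega), if_neg (show ¬(t = 2 * r + 2) by omega), if_neg (show ¬(t % 2 = 0 ∧ 2 ≤ t ∧ t ≤ r) by omega), if_neg (show ¬(t % 2 = 0 ∧ 4 * r + 8 ≤ t ∧ t ≤ 5 * r + 6) by omega), if_neg (show ¬(r % 2 = 1 ∧ t = r + 1) by omega), if_neg (show ¬(r % 2 = 0 ∧ 2 ≤ r ∧ t = 3 * r + 3) by omega), if_neg (show ¬(r % 2 = 1 ∧ t = 5 * r + 7) by omega), if_neg (show ¬(r % 2 = 0 ∧ 2 ≤ r ∧ t = 5 * r + 7) by omega), if_neg (show ¬(r % 2 = 0 ∧ 2 ≤ r ∧ t = r + 2) by omega), if_neg (show ¬(r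 % 2 = 1 ∧ t = 3 * r + 6) by omega), if_neg (show ¬(r % 2 = 0 ∧ 2 ≤ r ∧ t = (2 * k + 1) - r) by omega), if_neg (show ¬(r % 2 = 1 ∧ t = (2 * k + 1) - r) by omega), if_neg (show ¬(t % 2 = 0 ∧ r + 3 ≤ t ∧ t ≤ 2 * r) by omega), if_neg (show ¬(t % 2 = 1 ∧ (2 * k + 1) - r + 1 ≤ t) by omega), if_neg (show ¬(t = 2 * r + 3) by omega), if_neg (show ¬(t = 4 * r + 7) by omega), if_neg (show ¬(t % 2 = 1 ∧ 2 * r + 5 ≤ t ∧ t ≤ 3 * r + 2) by omega), if_neg (show ¬(t % 2 = 1 ∧ 4 * r + 9 ≤ t ∧ t ≤ 5 * r + 6) by omega), if_neg (show ¬(t = 3 * r + 5 - r % 2) by omega), if_neg (show ¬(t = 5 * r + 8) by omega), if_neg (show ¬(t % 2 = 1 ∧ 3 * r + 7 ≤ t ∧ t ≤ 4 * r + 5) by omega), if_pos hc]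
    rw [e]
    exact Or.inr (Or.inr (Or.inr (Or.inr (Or.inr (Or.inr (Or.inr (Or.inr (Or.inr (Or.inr (Or.inr (Or.inr (Or.inr (Or.inr (Or.inr (Or.inr (Or.inr (Or.inr (Or.inr (Or.inr (Or.inr (Or.inl ⟨hc, by omega⟩)))))))))))))))))))))
  · clear hb
    have e : σUOval r (2 * k + 1) t = t + 1 := by
      unfold σUOval
      rw [if_neg (show ¬(t = 0) by omega), if_neg (show ¬(t = 2 * r + 2) by omega), if_neg (show ¬(t % 2 = 0 ∧ 2 ≤ t ∧ t ≤ r) by omega), if_neg (show ¬(t % 2 = 0 ∧ 4 * r + 8 ≤ t ∧ t ≤ 5 * r + 6) by omega), if_neg (show ¬(r % 2 = 1 ∧ t = r + 1) by omega), if_neg (show ¬(r % 2 = 0 ∧ 2 ≤ r ∧ t = 3 * r + 3) by omega), if_neg (show ¬(r % 2 = 1 ∧ t = 5 * r + 7) by omega), if_neg (show ¬(r % 2 = 0 ∧ 2 ≤ r ∧ t = 5 * r + 7) by omega), if_neg (show ¬(r % 2 = 0 ∧ 2 ≤ r ∧ t = r + 2) by omega), if_neg (show ¬(r % 2 = 1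 ∧ t = 3 * r + 6) by omega), if_neg (show ¬(r % 2 = 0 ∧ 2 ≤ r ∧ t = (2 * k + 1) - r) by omega), if_neg (show ¬(r % 2 = 1 ∧ t = (2 * k + 1) - r) by omega), if_neg (show ¬(t % 2 = 0 ∧ r + 3 ≤ t ∧ t ≤ 2 * r) by omega), if_neg (show ¬(t % 2 = 1 ∧ (2 * k + 1) - r + 1 ≤ t) by omega), if_neg (show ¬(t = 2 * r + 3) by omega), if_neg (show ¬(t = 4 * r + 7) by omega), if_neg (show ¬(t % 2 = 1 ∧ 2 * r + 5 ≤ t ∧ t ≤ 3 * r + 2) by omega), if_neg (show ¬(t % 2 = 1 ∧ 4 * r + 9 ≤ t ∧ t ≤ 5 * r + 6) by omega), if_neg (show ¬(t = 3 * r + 5 - r % 2) by omega), if_neg (show ¬(t = 5 * r + 8) by omega), if_neg (show ¬(t % 2 = 1 ∧ 3 * r + 7 ≤ t ∧ t ≤ 4 * r + 5) by omega), if_neg (show ¬(t % 2 = 0 ∧ (2 * k + 1) - r + 1 ≤ t) by omega), if_pos hc]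
    rw [e]
    exact Or.inr (Or.inr (Or.inr (Or.inr (Or.inr (Or.inr (Or.inr (Or.inr (Or.inr (Or.inr (Or.inr (Or.inr (Or.inr (Or.inr (Or.inr (Or.inr (Or.inr (Or.inr (Or.inr (Or.inr (Or.inr (Or.inr (Or.inl ⟨hc, by omega⟩))))))))))))))))))))))
  · clear hb
    have e : σUOval r (2 * k + 1) t = t - 1 := by
      unfold σUOval
      rw [if_neg (show ¬(t = 0) by omega), if_neg (show ¬(t = 2 * r + 2) by omega), if_neg (show ¬(t % 2 = 0 ∧ 2 ≤ t ∧ t ≤ r) by omega), if_neg (show ¬(t % 2 = 0 ∧ 4 * r + 8 ≤ t ∧ t ≤ 5 * r + 6) by omega), if_neg (show ¬(r % 2 = 1 ∧ t = r + 1) by omega), if_neg (show ¬(r % 2 = 0 ∧ 2 ≤ r ∧ t = 3 * r + 3) by omega), if_neg (show ¬(r % 2 = 1 ∧ t = 5 * r + 7) by omega), if_neg (show ¬(r % 2 = 0 ∧ 2 ≤ r ∧ t = 5 * r + 7) by omega), if_neg (show ¬(r % 2 = 0 ∧ 2 ≤ r ∧ t = r + 2) by omega), if_neg (show ¬(r %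 2 = 1 ∧ t = 3 * r + 6) by omega), if_neg (show ¬(r % 2 = 0 ∧ 2 ≤ r ∧ t = (2 * k + 1) - r) by omega), if_neg (show ¬(r % 2 = 1 ∧ t = (2 * k + 1) - r) by omega), if_neg (show ¬(t % 2 = 0 ∧ r + 3 ≤ t ∧ t ≤ 2 * r) by omega), if_neg (show ¬(t % 2 = 1 ∧ (2 * k + 1) - r + 1 ≤ t) by omega), if_neg (show ¬(t = 2 * r + 3) by omega), if_neg (show ¬(t = 4 * r + 7) by omega), if_neg (show ¬(t % 2 = 1 ∧ 2 * r + 5 ≤ t ∧ t ≤ 3 * r + 2) by omega), if_neg (show ¬(t % 2 = 1 ∧ 4 * r + 9 ≤ t ∧ t ≤ 5 * r + 6) by omega), if_neg (show ¬(t = 3 * r + 5 - r % 2) by omega), if_neg (show ¬(t = 5 * r + 8) by omega), if_neg (show ¬(t % 2 = 1 ∧ 3 * r + 7 ≤ t ∧ t ≤ 4 * r + 5) by omega), if_neg (show ¬(t % 2 = 0 ∧ (2 * k + 1) - r + 1 ≤ t) by omega), if_neg (show ¬(5 * r + 9 ≤ t ∧ t + r + 2 ≤ (2 * k + 1) ∧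 (t + r) % 2 = 1) by omega), if_pos hc]
    rw [e]
    exact Or.inr (Or.inr (Or.inr (Or.inr (Or.inr (Or.inr (Or.inr (Or.inr (Or.inr (Or.inr (Or.inr (Or.inr (Or.inr (Or.inr (Or.inr (Or.inr (Or.inr (Or.inr (Or.inr (Or.inr (Or.inr (Or.inr (Or.inr (⟨hc, by omega⟩)))))))))))))))))))))))

set_option maxHeartbeats 4000000 in
/-- LightConeWindowHard helper `vUO_σUO` (decomp-qadv land package; see the module docstring). -/
theorem vUO_σUO (r k : ℕ) (hk : 3 * r + 4 ≤ k) (b : Fin (2 * k + 1)) (hb : vUO r _ b = true) :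
    vUO r _ (σUO r k b) = true := by
  have h := σUO_val r k hk b hb
  simp only [vUO, decide_eq_true_eq]
  omega

set_option maxHeartbeats 8000000 in
/-- LightConeWindowHard helper `window_σUO` (decomp-qadv land package; see the module docstring). -/
theorem window_σUO (r k : ℕ) (hk : 3 * r + 4 ≤ k) (b : Fin (2 * k + 1)) (hb : vUO r _ b = true) :
    window r (xUO r _) (σUO r k b) = window r (xUO r _) b := by
  have h := σUO_val r k hk b hb
  have hlt := b.isLt
  funext d
  have hd := d.isLt
  rw [window_apply r (by omega), window_apply r (by omega)]
  simp only [xUO, decide_eq_decide]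
  generalize ((σUO r k b : Fin _) : ℕ) = s at *
  generalize (d : ℕ) = dd at *
  generalize (b : ℕ) = t at *
  rcases h with ⟨hc, hs⟩ | ⟨hc, hs⟩ | ⟨hc, hs⟩ | ⟨hc, hs⟩ | ⟨hc, hs⟩ | ⟨hc, hs⟩ | ⟨hc, hs⟩ | ⟨hc, hs⟩ | ⟨hc, hs⟩ | ⟨hc, hs⟩ | ⟨hc, hs⟩ | ⟨hc, hs⟩ | ⟨hc, hs⟩ | ⟨hc, hs⟩ | ⟨hc, hs⟩ | ⟨hc, hs⟩ | ⟨hc, hs⟩ | ⟨hc, hs⟩ | ⟨hc, hs⟩ | ⟨hc, hs⟩ | ⟨hc, hs⟩ | ⟨hc, hs⟩ | ⟨hc, hs⟩ | ⟨hc, hs⟩ <;> (split_ifs <;> omega)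

set_option maxHeartbeats 4000000 in
/-- LightConeWindowHard helper `σUO_ne` (decomp-qadv land package; see the module docstring). -/
theorem σUO_ne (r k : ℕ) (hk : 3 * r + 4 ≤ k) (b : Fin (2 * k + 1)) (hb : vUO r _ b = true) : σUO r k b ≠ b := by
  have h := σUO_val r k hk b hb
  intro he
  have h' := congrArg Fin.val he
  omega

set_option maxHeartbeats 8000000 in
/-- LightConeWindowHard helper `σUO_σUO` (decomp-qadv land package; see the module docstring). -/
theorem σUO_σUO (r k : ℕ) (hk : 3 * r + 4 ≤ k) (b : Fin (2 * k + 1)) (hb : vUO r _ b = true) :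
    σUO r k (σUO r k b) = b := by
  have h1 := σUO_val r k hk b hb
  have h2 := σUO_val r k hk (σUO r k b) (vUO_σUO r k hk b hb)
  apply Fin.ext
  omega

/-- ★★★ THE UNIFORM ODD FAMILY: for every radius `r` and every odd `n = 2k+1 ≥ 6r+9`, every window-`(2r+1)` strategy loses
on the input with ones at `0, 1, 2r+2, 2r+3, 4r+6, 4r+7`. -/
theorem xUO_universalHard (r k : ℕ) (hk : 3 * r + 4 ≤ k) : UniversalHard r (xUO r (2 * k + 1)) :=
  universalHard_of_pairing r (xUO r _) (vUO r _) (σUO r k) (oddZeros_xUO r k hk) (inKernel_vUO r k hk)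
    (signBit_vUO r k hk) (vUO_σUO r k hk) (window_σUO r k hk) (σUO_ne r k hk) (σUO_σUO r k hk)

/-- ★★★ The odd half, PROVED uniformly in `r`. -/
theorem universalHardOddAll : UniversalHardOddAll := by
  intro r
  refine ⟨6 * r + 9, fun n hn ho => ?_⟩
  obtain ⟨k, rfl⟩ : ∃ k, n = 2 * k + 1 := ⟨n / 2, by omega⟩
  exact ⟨xUO r _, xUO_universalHard r k (by omega)⟩

/-- Universal-hard inputs exist for EVERY radius and EVERY `n ≥ 6r+9`. -/
theorem universalHard_all (r n : ℕ) (hn : 6 * r + 9 ≤ n) : ∃ x : Fin n → Bool, UniversalHard r x := by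
  rcases Nat.mod_two_eq_zero_or_one n with he | ho
  · exact universalHardEvenAll r n (by omega) he
  · obtain ⟨k, rfl⟩ : ∃ k, n = 2 * k + 1 := ⟨n / 2, by omega⟩
    exact ⟨xUO r _, xUO_universalHard r k (by omega)⟩

/-- ★★★★ THE UNIFORM RUNG IS A THEOREM: `WindowSymHard3All` — for every window radius `r` there is `n₀ = 6r+9` such that
for all `n ≥ n₀` every rotation-covariant strategy reading a `(2r+1)`-window of `x` plus `|x| mod 3` fails the ring-HLF
relation on some odd-class input. -/
theorem windowSymHard3All : WindowSymHard3All := windowSymHard3All_of_odd universalHardOddAll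

/-- Explicit threshold form. -/
theorem windowSymHard3_all_explicit (r : ℕ) : ∀ n ≥ 6 * r + 9, ∀ F : (Fin (2 * r + 1) → Bool) → ZMod 3 → Bool,
    ∃ x : Fin n → Bool, OddZeros x ∧ ¬ RingHLF.Rel x (windowStrat r F x) := by
  intro n hn F
  obtain ⟨x, hodd, hx⟩ := universalHard_all r n hn
  exact ⟨x, hodd, hx (fun w => F w (count3 x))⟩

/-- ARBITRARY GLOBAL ADVICE: for every radius `r` and `n ≥ 6r+9` ONE odd-class input defeats every radius-`r` window
strategy with ANY advice `g x` of ANY type (the advice is constant along the input, so it is absorbed into `F`). -/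
theorem windowHard_any_advice (r n : ℕ) (hn : 6 * r + 9 ≤ n) :
    ∃ x : Fin n → Bool, OddZeros x ∧ ∀ (A : Type) (g : (Fin n → Bool) → A) (F : (Fin (2 * r + 1) → Bool) → A → Bool),
      ¬ RingHLF.Rel x (fun i => F (window r x i) (g x)) := by
  obtain ⟨x, hodd, hx⟩ := universalHard_all r n hn
  exact ⟨x, hodd, fun A g F => hx (fun w => F w (g x))⟩

end UniformOdd


/-- Corollaries: the first two rungs. -/
theorem windowSymHard3_one : WindowSymHard3 1 := windowSymHard3All 1
/-- LightConeWindowHard helper `windowSymHard3_two` (decomp-qadv land package; see the module docstring). -/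
theorem windowSymHard3_two : WindowSymHard3 2 := windowSymHard3All 2

end Summit.QuantumAdvantage.AdviceFreeQNC0.LightConeWindowHard
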